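/-
Copyright (c) 2026. All rights reserved.
Released under Apache 2.0 license as described in the file LICENSE.
-/
import Summits.HubbardSuperconductivity.HubbardLadder.Bounds.AdjacentRatioWindow
import HarnessLib

/-!
# The ratio envelope from an adjacent-sector ratio bound (bounds.tex §13, Lemma 13.5)

HONEST FRAMING: ladder R1–R4 with certified numbers; no claim on H/H₀. These are bounds for
MODEL CLASSES (the typed repulsive/attractive Hubbard torus with a flux twist), no materials
claim. This file is MODEL-FREE (imports `AdjacentRatioWindow` only): it converts an
ADJACENT-SECTOR RATIO BOUND

`|(n - k) w k - (k + 1) w (k+1)| ≤ n r w (k+1)`     (`k + 1 ≤ n`, `0 ≤ r`)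

for a positive weight sequence `w` on `{0, …, n}` — for the canonical sector weights of a
lattice fermion system with `n` orbitals this is the operator identity
`Σ_i Tr(P_k c_i c†_i e^{-βH}) = (n - k) Z_k = (k+1) Z_{k+1} + Σ_i Tr(P_{k+1} c†_i [e^{-βH}, c_i])`
with `r ≥ max_i ‖e^{-βH} c_i e^{βH} - c_i‖` (a successor part) — into the two antitone RATIO
ENVELOPES consumed by `adjacent_ratio_window_sector`:

* `ratioAm n r s k = e^{s} (n - k)/(k + 1 + n r)` (lower envelope, all `k + 1 ≤ n`) and
  `ratioAp n r s k = e^{s} (n - k)/(k + 1 - n r)` (upper envelope, on `n r < k_L + 1 ≤ k + 1`),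
  with positivity and antitonicity on these ranges (`ratioAm_pos`, `ratioAm_antitone`,
  `ratioAp_antitone`);
* `envelope_lo_of_ratio_bound`, `envelope_hi_of_ratio_bound`: the envelopes;
* `walk_input_of_ratio_bound`: the walk hypotheses `hG`, `hadj` of
  `SectorTwistRatio.norm_ttSectorZ_twist_sub_le` from the ratio bound, the Chebyshev input
  `Var(s) ≤ K²/4`, `|m(s) - N| ≤ K₀`, `K₀ + 2K + 2 ≤ K_w ≤ N`, `N + K_w ≤ n` and the separation
  `n r < N - K_w + 1`, with the rate `G = log C`,
  `C = ratioWalkConstant n N K_w r s = A⁺ (N - K_w) / A⁻ (N + K_w - 1)`.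

No numerics, no `native_decide`; standard axioms only. References: folklore; programme notes
bounds.tex §13.
-/

noncomputable section

namespace Summit.HubbardSuperconductivity.HubbardLadder.Bounds

open Finset Real

variable {w : ℕ → ℝ} {n : ℕ}

/-! ### The two envelopes -/

/-- The lower ratio envelope `A⁻ k = e^{s} (n - k) / (k + 1 + n r)`.
[programme definition: bounds.tex §13, Lemma 13.5] -/
def ratioAm (n : ℕ) (r s : ℝ) (k : ℕ) : ℝ := exp s * ((n : ℝ) - k) / ((k : ℝ) + 1 + n * r)

/-- The upper ratio envelope `A⁺ k = e^{s} (n - k) / (k + 1 - n r)`.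
[programme definition: bounds.tex §13, Lemma 13.5] -/
def ratioAp (n : ℕ) (r s : ℝ) (k : ℕ) : ℝ := exp s * ((n : ℝ) - k) / ((k : ℝ) + 1 - n * r)

/-- `A⁻ k > 0` for `k + 1 ≤ n`, `0 ≤ r`. [this file] -/
theorem ratioAm_pos {r : ℝ} (hr : 0 ≤ r) (s : ℝ) {k : ℕ} (hk : k + 1 ≤ n) :
    0 < ratioAm n r s k := by
  unfold ratioAm
  have hk' : ((k : ℕ) : ℝ) + 1 ≤ n := by exact_mod_cast hk
  exact div_pos (mul_pos (exp_pos s) (by linarith)) (by positivity)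

/-- `A⁻` is antitone on `k + 1 ≤ n` (`0 ≤ r`). [this file] -/
theorem ratioAm_antitone {r : ℝ} (hr : 0 ≤ r) (s : ℝ) {i j : ℕ} (hij : i ≤ j) (hj : j + 1 ≤ n) :
    ratioAm n r s j ≤ ratioAm n r s i := by
  unfold ratioAm
  have hj' : ((j : ℕ) : ℝ) + 1 ≤ n := by exact_mod_cast hj
  have hij' : ((i : ℕ) : ℝ) ≤ j := by exact_mod_cast hij
  have hn : (0 : ℝ) ≤ n * r := by positivity
  rw [mul_div_assoc, mul_div_assoc]
  refine mul_le_mul_of_nonneg_left ?_ (exp_pos s).le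
  rw [div_le_div_iff₀ (by positivity) (by positivity)]
  nlinarith

/-- `A⁺` is antitone on `k_L ≤ i ≤ j`, `j + 1 ≤ n`, provided `n r < k_L + 1`. [this file] -/
theorem ratioAp_antitone {r : ℝ} (hr : 0 ≤ r) (s : ℝ) {kL i j : ℕ} (hsep : (n : ℝ) * r < kL + 1)
    (hi : kL ≤ i) (hij : i ≤ j) (hj : j + 1 ≤ n) : ratioAp n r s j ≤ ratioAp n r s i := by
  unfold ratioAp
  have hj' : ((j : ℕ) : ℝ) + 1 ≤ n := by exact_mod_cast hj
  have hij' : ((i : ℕ) : ℝ) ≤ j := by exact_mod_cast hij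
  have hi' : ((kL : ℕ) : ℝ) ≤ i := by exact_mod_cast hi
  have hdi : 0 < ((i : ℕ) : ℝ) + 1 - n * r := by linarith
  have hdj : 0 < ((j : ℕ) : ℝ) + 1 - n * r := by linarith
  rw [mul_div_assoc, mul_div_assoc]
  refine mul_le_mul_of_nonneg_left ?_ (exp_pos s).le
  rw [div_le_div_iff₀ hdj hdi]
  have hn : (0 : ℝ) ≤ n * r := by positivity
  nlinarith

/-! ### The envelopes from the ratio bound -/

/-- LOWER ENVELOPE from the ratio bound: `(n - k) w k ≤ (k + 1 + n r) w (k+1)` gives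
`A⁻ k · e^{sk} w k ≤ e^{s(k+1)} w (k+1)`. [this file; bounds.tex Lemma 13.5] -/
theorem envelope_lo_of_ratio_bound (hw : ∀ k ≤ n, 0 < w k) {r : ℝ} (hr : 0 ≤ r) (s : ℝ)
    (hratio : ∀ k : ℕ, k + 1 ≤ n →
      |((n : ℝ) - k) * w k - ((k : ℝ) + 1) * w (k + 1)| ≤ n * r * w (k + 1)) :
    ∀ k : ℕ, k + 1 ≤ n →
      ratioAm n r s k * (exp (s * k) * w k) ≤ exp (s * ((k + 1 : ℕ) : ℝ)) * w (k + 1) := by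
  intro k hk
  have hb := (abs_le.1 (hratio k hk)).2
  have hden : 0 < ((k : ℕ) : ℝ) + 1 + n * r := by positivity
  have hwk1 : 0 < w (k + 1) := hw (k + 1) hk
  have hq : ((n : ℝ) - k) / (((k : ℕ) : ℝ) + 1 + n * r) * w k ≤ w (k + 1) := by
    rw [div_mul_eq_mul_div, div_le_iff₀ hden]
    linarith
  have he : exp (s * ((k + 1 : ℕ) : ℝ)) = exp s * exp (s * k) := by
    rw [← Real.exp_add]; push_cast; ring_nf
  unfold ratioAm
  rw [he]
  calc exp s * ((n : ℝ) - k) / (((k : ℕ) : ℝ) + 1 + n * r) * (exp (s * k) * w k)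
      = exp s * exp (s * k) * (((n : ℝ) - k) / (((k : ℕ) : ℝ) + 1 + n * r) * w k) := by ring
    _ ≤ exp s * exp (s * k) * w (k + 1) := mul_le_mul_of_nonneg_left hq (by positivity)

/-- UPPER ENVELOPE from the ratio bound on `n r < k_L + 1 ≤ k + 1`:
`(k + 1 - n r) w (k+1) ≤ (n - k) w k` gives `e^{s(k+1)} w (k+1) ≤ A⁺ k · e^{sk} w k`.
[this file; bounds.tex Lemma 13.5] -/
theorem envelope_hi_of_ratio_bound (hw : ∀ k ≤ n, 0 < w k) {r : ℝ} (s : ℝ)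
    (hratio : ∀ k : ℕ, k + 1 ≤ n →
      |((n : ℝ) - k) * w k - ((k : ℝ) + 1) * w (k + 1)| ≤ n * r * w (k + 1))
    {kL : ℕ} (hsep : (n : ℝ) * r < kL + 1) :
    ∀ k : ℕ, kL ≤ k → k + 1 ≤ n →
      exp (s * ((k + 1 : ℕ) : ℝ)) * w (k + 1) ≤ ratioAp n r s k * (exp (s * k) * w k) := by
  intro k hkL hk
  have hb := (abs_le.1 (hratio k hk)).1
  have hkL' : ((kL : ℕ) : ℝ) ≤ k := by exact_mod_cast hkL
  have hden : 0 < ((k : ℕ) : ℝ) + 1 - n * r := by linarith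
  have hwk : 0 < w k := hw k (by omega)
  have hq : w (k + 1) ≤ ((n : ℝ) - k) / (((k : ℕ) : ℝ) + 1 - n * r) * w k := by
    rw [div_mul_eq_mul_div, le_div_iff₀ hden]
    linarith
  have he : exp (s * ((k + 1 : ℕ) : ℝ)) = exp s * exp (s * k) := by
    rw [← Real.exp_add]; push_cast; ring_nf
  unfold ratioAp
  rw [he]
  calc exp s * exp (s * k) * w (k + 1)
      ≤ exp s * exp (s * k) * (((n : ℝ) - k) / (((k : ℕ) : ℝ) + 1 - n * r) * w k) :=
        mul_le_mul_of_nonneg_left hq (by positivity)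
    _ = exp s * ((n : ℝ) - k) / (((k : ℕ) : ℝ) + 1 - n * r) * (exp (s * k) * w k) := by ring

/-! ### The walk input from the ratio bound -/

/-- The walk rate constant `C = A⁺ (N - K_w) / A⁻ (N + K_w - 1)` of the ratio envelopes.
[programme definition: bounds.tex §13, Lemma 13.5] -/
def ratioWalkConstant (n N Kw : ℕ) (r s : ℝ) : ℝ :=
  ratioAp n r s (N - Kw) / ratioAm n r s (N + Kw - 1)

/-- THE WALK INPUT FROM THE RATIO BOUND (exactly the hypotheses `hG`, `hadj` of
`norm_ttSectorZ_twist_sub_le`, with `G = log C`, `C = ratioWalkConstant n N K_w r s`). Assume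
the adjacent-sector ratio bound with constant `r ≥ 0`, the Chebyshev input `Var(s) ≤ K²/4`,
`|m(s) - N| ≤ K₀`, `K₀ + 2K + 2 ≤ K_w ≤ N`, `N + K_w ≤ n` and the separation `n r < N - K_w + 1`.
Then `G ≥ 0` and for `N - K_w ≤ k`, `k + 1 ≤ min (N + K_w) n`:
`e^{s(k+1)} w (k+1) ≤ e^{G} e^{sk} w k` and `e^{sk} w k ≤ e^{G} e^{s(k+1)} w (k+1)`. Proof:
`adjacent_ratio_window_sector` with the envelopes clamped to the index range `k + 1 ≤ n`
(`A⁻ (min k (n-1))`, `A⁺ (max (N - K_w) (min k (n-1)))`), where they are positive and antitone.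
[folklore second-moment method; this file] -/
theorem walk_input_of_ratio_bound (hw : ∀ k ≤ n, 0 < w k) (s : ℝ) {K K₀ r : ℝ} (hK : 0 < K)
    (hV : gcVar w n s ≤ K ^ 2 / 4) (hr : 0 ≤ r)
    (hratio : ∀ k : ℕ, k + 1 ≤ n →
      |((n : ℝ) - k) * w k - ((k : ℝ) + 1) * w (k + 1)| ≤ n * r * w (k + 1))
    {N Kw : ℕ} (hm : |gcMean w n s - N| ≤ K₀) (hKw : K₀ + 2 * K + 2 ≤ Kw) (hKwN : Kw ≤ N)
    (hNn : N + Kw ≤ n) (hsep : (n : ℝ) * r < ((N - Kw : ℕ) : ℝ) + 1) :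
    0 ≤ Real.log (ratioWalkConstant n N Kw r s) ∧
      ∀ k : ℕ, N - Kw ≤ k → k + 1 ≤ min (N + Kw) n →
        Real.exp (s * (k + 1 : ℕ)) * w (k + 1) ≤
            Real.exp (Real.log (ratioWalkConstant n N Kw r s)) * (Real.exp (s * k) * w k) ∧
          Real.exp (s * k) * w k ≤
            Real.exp (Real.log (ratioWalkConstant n N Kw r s)) *
              (Real.exp (s * (k + 1 : ℕ)) * w (k + 1)) := by
  have hK₀ : 0 ≤ K₀ := (abs_nonneg _).trans hm
  have hKw2 : (2 : ℝ) < Kw := by linarith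
  have hKw2' : 2 < Kw := by exact_mod_cast hKw2
  have hn1 : 1 ≤ n := by omega
  have hC : walkConstant (fun k => ratioAm n r s (min k (n - 1)))
      (fun k => ratioAp n r s (max (N - Kw) (min k (n - 1)))) (N - Kw) (N + Kw - 1) =
      ratioWalkConstant n N Kw r s := by
    unfold walkConstant ratioWalkConstant
    beta_reduce
    rw [min_eq_left (show N - Kw ≤ n - 1 by omega), max_eq_left le_rfl,
      min_eq_left (show N + Kw - 1 ≤ n - 1 by omega)]
  rw [← hC]
  refine adjacent_ratio_window_sector hw s hK hV
    (Am := fun k => ratioAm n r s (min k (n - 1)))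
    (Ap := fun k => ratioAp n r s (max (N - Kw) (min k (n - 1))))
    (fun k => ratioAm_pos hr s (by omega)) (fun i j hij => ?_) (fun i j hij => ?_)
    (fun k hk => ?_) (fun k hkL hk => ?_) hm hKw hKwN hNn
  · exact ratioAm_antitone hr s (show min i (n - 1) ≤ min j (n - 1) by omega) (by omega)
  · exact ratioAp_antitone hr s hsep (show N - Kw ≤ max (N - Kw) (min i (n - 1)) by omega)
      (show max (N - Kw) (min i (n - 1)) ≤ max (N - Kw) (min j (n - 1)) by omega) (by omega)
  · simp only [min_eq_left (show k ≤ n - 1 by omega)]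
    exact envelope_lo_of_ratio_bound hw hr s hratio k hk
  · simp only [min_eq_left (show k ≤ n - 1 by omega), max_eq_right hkL]
    exact envelope_hi_of_ratio_bound hw s hratio hsep k hkL hk

end Summit.HubbardSuperconductivity.HubbardLadder.Bounds
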